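import Summits.CriticalPhenomena.PercolationContinuityZ3.Theorems.Transplant.FKConnectivityAllQSPNetworks
import Summits.CriticalPhenomena.PercolationContinuityZ3.Theorems.Transplant.FKConnectivityAllQSPReroot
import Summits.CriticalPhenomena.PercolationContinuityZ3.Theorems.Transplant.FKConnectivityAllQTwoTree
import HarnessLib

/-!
# Connectivity correlation inequalities for `φ_{w,q}`, every `q > 0` — file 16: BRIDGE — every 2-tree is a two-terminal series–parallel
# network between the endpoints of each of its edges; the `q`-uniform theorems on 2-tree supports

Support file (`--supports stmt-CriticalPhenomena-4575`), FK sub-lane `prim-bschramm-fk-2` (gen 7) of the post-continuity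
programme; builds on p205010 (kernel theorem, internal audit signed; external expert review pending).  No definitions, no named
facts, no sorries; standard axioms.

The lane holds two kernel proofs of Wagner's theorem (graph case) on series–parallel supports: fk-1 g5's on 2-TREES (`FK.IsTwoTree`,
`…AllQTwoTree.lean`, apex elimination; edge-negative association for all pairs, `0 < q ≤ 1`) and fk-2 g7's on TWO-TERMINAL SERIES–PARALLEL
NETWORKS (`FK.IsTTSP`, `…AllQSPWagner.lean`, transfer matrices; EC⁺ / monotonicity / hub for EVERY `q > 0`).  This file identifies the classes
in the direction needed to transfer the `q`-uniform statements:
* `FK.IsTTSP.of_isTwoTree` — if `T` is a 2-tree and `xy ∈ T`, then `T` is a two-terminal series–parallel network between `x` and `y`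
  (induction on the 2-tree with `IsTTSP.subdivide_parallel` / `IsTTSP.apex_terminal` of `…AllQSPNetworks.lean`).
* `FK.edgeNegCorrSupp_of_isTTSP` — the TTSP line's all-pairs theorem (`…AllQSPReroot.lean`) in fk-1's vocabulary:
  `EdgeNegCorrSupp (E ∪ {st}) q` for `0 < q ≤ 1`; `FK.edgeNegCorrSupp_of_isTwoTree'` — a second route to fk-1's theorem through the bridge.
* consequences on 2-tree supports for EVERY `q > 0` (fk-1's file has the `q < 1` / `q ≤ 1` ones): `FK.edgeConnMono_of_isTwoTree`
  (EC⁺ at every pair of the 2-tree), `FK.rcMeasureW_real_openConn_mono_of_isTwoTree` (`φ_{w,q}(x ↔ y)` non-decreasing in every parameter,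
  `xy ∈ T`), `FK.pairConnPosUnder_of_isTwoTree_of_pos` / `FK.hubUnder_of_isTwoTree_of_pos` (pairwise positive correlation / ALR (13)).
(Wald–Colbourn 1983 / Duffin 1965: subgraphs of 2-trees = `K₄`-minor-free graphs — not formalised; with it and `…AllQSeriesParallel.lean`'s
named-fact route these give the same statements on all `K₄`-minor-free supports.)
[cite: Wagner2006, Thm. 5.8(d), §5.3] [cite: Grimmett2006, Thm. (3.21) (p. 43); §3.9 (pp. 63–64)] [cite: AyyerLinussonRavichandran2025, §7 eq. (13) (p. 22)]
-/

noncomputable section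

namespace Summit.CriticalPhenomena.PercolationContinuityZ3.Theorems

namespace FK

open MeasureTheory Literature.Probability.LatticeModels Literature.Probability.Percolation
open scoped Classical

variable {V : Type*}

/-! ### 2-trees are two-terminal series–parallel between the endpoints of each edge -/

/-- **Every 2-tree is a two-terminal series–parallel network between the endpoints of each of its edges.** [folklore] -/
theorem IsTTSP.of_isTwoTree {T : Set (Sym2 V)} (hT : IsTwoTree T) :
    ∀ {x y : V}, s(x, y) ∈ T → ∃ E : Finset (Sym2 V), (↑E : Set (Sym2 V)) = T ∧ IsTTSP E x y := by
  induction hT with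
  | @pair u v huv =>
    intro x y hxy
    rw [Set.mem_singleton_iff] at hxy
    have hne : x ≠ y := by
      intro h; subst h
      rcases Sym2.eq_iff.1 hxy with ⟨h1, h2⟩ | ⟨h1, h2⟩
      · exact huv (h1.symm.trans h2)
      · exact huv (h2.symm.trans h1)
    exact ⟨{s(x, y)}, by rw [Finset.coe_singleton, hxy], IsTTSP.edge hne⟩
  | @cons T u v a hT huv ha ih =>
    intro x y hxy
    -- the 2-tree below, as a network between `u` and `v`
    obtain ⟨E, hE, hEuv⟩ := ih huv
    have haE : ∀ e ∈ E, a ∉ e := fun e he => ha e (hE ▸ (Finset.mem_coe.2 he))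
    have hset : (↑(E ∪ ({s(u, a)} ∪ {s(a, v)})) : Set (Sym2 V)) = T ∪ {s(u, a), s(a, v)} := by
      rw [Finset.coe_union, Finset.coe_union, Finset.coe_singleton, Finset.coe_singleton, hE]; rfl
    rcases hxy with hxy | hxy
    · -- the pair lies in the old 2-tree
      obtain ⟨E', hE', hE'xy⟩ := ih hxy
      have hEE' : E' = E := Finset.coe_injective (hE'.trans hE.symm)
      subst hEE'
      exact ⟨E' ∪ ({s(u, a)} ∪ {s(a, v)}), hset, hE'xy.subdivide_parallel (Finset.mem_coe.1 (hE'.symm ▸ huv)) haE⟩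
    · -- the pair is one of the two new edges at the apex `a`
      rcases hxy with hxy | hxy
      · -- `s(x,y) = s(u,a)`
        have key : IsTTSP (E ∪ ({s(u, a)} ∪ {s(a, v)})) u a := hEuv.apex_terminal haE
        rcases Sym2.eq_iff.1 hxy with ⟨rfl, rfl⟩ | ⟨rfl, rfl⟩
        · exact ⟨_, hset, key⟩
        · exact ⟨_, hset, key.symm⟩
      · -- `s(x,y) = s(a,v)`
        rw [Set.mem_singleton_iff] at hxy
        have key : IsTTSP (E ∪ ({s(v, a)} ∪ {s(a, u)})) v a := hEuv.symm.apex_terminal haE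
        have hset' : E ∪ ({s(v, a)} ∪ {s(a, u)}) = E ∪ ({s(u, a)} ∪ {s(a, v)}) := by
          rw [Finset.union_comm {s(v, a)} {s(a, u)}, Sym2.eq_swap (a := a) (b := u), Sym2.eq_swap (a := v) (b := a)]
        rw [hset'] at key
        rcases Sym2.eq_iff.1 hxy with ⟨rfl, rfl⟩ | ⟨rfl, rfl⟩
        · exact ⟨_, hset, key.symm⟩
        · exact ⟨_, hset, key⟩

/-! ### The `q`-uniform theorems on 2-tree supports -/

section Consequences

variable [Fintype V] {q : ℝ} {T : Set (Sym2 V)}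

/-- **EC⁺ on 2-tree supports, every `q > 0`**: `φ_{w[f↦0],q}(x ↔ y) ≤ φ_{w[f↦1],q}(x ↔ y)` for `xy ∈ T`, `w` supported in the 2-tree `T`,
`f` fractional. [cite: Wagner2006, Thm. 5.8(d), §5.3] [cite: Grimmett2006, Thm. (3.21) (p. 43); §3.9 (p. 63)] -/
theorem edgeConnMono_of_isTwoTree (hq : 0 < q) (hT : IsTwoTree T) {x y : V} (hxy : s(x, y) ∈ T) (w : Sym2 V → unitInterval)
    (hw : ∀ e, ((w e : unitInterval) : ℝ) ≠ 0 → e ∈ T) (f : Sym2 V) (hf0 : 0 < ((w f : unitInterval) : ℝ))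
    (hf1 : ((w f : unitInterval) : ℝ) < 1) :
    (rcMeasureW (Function.update w f 0) q ∅).real (openConn x y) ≤
      (rcMeasureW (Function.update w f 1) q ∅).real (openConn x y) := by
  obtain ⟨E, hE, hExy⟩ := IsTTSP.of_isTwoTree hT hxy
  exact edgeConnMono_of_isTTSP hq hExy w (fun e he => hE.symm ▸ hw e he) f hf0 hf1

/-- **Monotonicity in the parameters on 2-tree supports, every `q > 0`**: `w ≤ w'` supported in the 2-tree `T ∋ xy` ⇒
`φ_{w,q}(x ↔ y) ≤ φ_{w',q}(x ↔ y)`. [cite: Grimmett2006, Thm. (3.21) (p. 43); §3.9 (p. 63); §5.8 (p. 131)] [cite: Wagner2006, §5.3] -/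
theorem rcMeasureW_real_openConn_mono_of_isTwoTree (hq : 0 < q) (hT : IsTwoTree T) {x y : V} (hxy : s(x, y) ∈ T)
    {w w' : Sym2 V → unitInterval} (hww : ∀ e, w e ≤ w' e) (hw' : ∀ e, ((w' e : unitInterval) : ℝ) ≠ 0 → e ∈ T) :
    (rcMeasureW w q ∅).real (openConn x y) ≤ (rcMeasureW w' q ∅).real (openConn x y) := by
  obtain ⟨E, hE, hExy⟩ := IsTTSP.of_isTwoTree hT hxy
  exact rcMeasureW_real_openConn_mono_of_isTTSP hq hExy hww (fun e he => hE.symm ▸ hw' e he)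

/-- **Pairwise positive correlation of connection events on 2-tree supports, every `q > 0`** (the `q < 1` case is fk-1's
`FK.pairConnPosUnder_of_isTwoTree`). [cite: AyyerLinussonRavichandran2025, §7 eq. (13)–(15) (p. 22)] [cite: Wagner2006, §5.3] -/
theorem pairConnPosUnder_of_isTwoTree_of_pos (hq : 0 < q) (hT : IsTwoTree T) {x y u v : V} (hxy : s(x, y) ∈ T)
    (huv : s(u, v) ∈ T) (w : Sym2 V → unitInterval) (hw : ∀ e, ((w e : unitInterval) : ℝ) ≠ 0 → e ∈ T) :
    PairConnPosUnder (rcMeasureW w q ∅) x y u v := by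
  obtain ⟨E, hE, hExy⟩ := IsTTSP.of_isTwoTree hT hxy
  obtain ⟨E', hE', hEuv⟩ := IsTTSP.of_isTwoTree hT huv
  have hEE' : E' = E := Finset.coe_injective (hE'.trans hE.symm)
  subst hEE'
  exact pairConnPosUnder_of_isTTSP hq hExy hEuv w (fun e he => hE'.symm ▸ hw e he)

/-- **The hub inequality on 2-tree supports, every `q > 0`** (ALR 2025 (13); the `q < 1` case is fk-1's `FK.hubUnder_of_isTwoTree`).
[cite: AyyerLinussonRavichandran2025, §7 eq. (13), Conj. 7.1 (p. 22)] [cite: Wagner2006, §5.3] -/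
theorem hubUnder_of_isTwoTree_of_pos (hq : 0 < q) (hT : IsTwoTree T) {o a b : V} (hoa : s(o, a) ∈ T) (hba : s(b, a) ∈ T)
    (w : Sym2 V → unitInterval) (hw : ∀ e, ((w e : unitInterval) : ℝ) ≠ 0 → e ∈ T) :
    HubUnder (rcMeasureW w q ∅) o a b :=
  hubUnder_of_pairConnPosUnder _ o a b (pairConnPosUnder_of_isTwoTree_of_pos hq hT hoa hba w hw)

end Consequences

/-! ### The TTSP line in fk-1's vocabulary: `EdgeNegCorrSupp` of a completed two-terminal series–parallel support -/

/-- **Wagner's theorem on the TTSP class, stated with `FK.EdgeNegCorrSupp`** (`…AllQTwoTree.lean`): for `0 < q ≤ 1` and a two-terminal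
series–parallel network `E` between `s, t`, every weight vector supported in `E ∪ {st}` gives an edge-negatively associated `φ_{w,q}`
(`FK.edgeNegCorr_supp_of_isTTSP_of_le_one` repackaged). [cite: Wagner2006, Ex. 5.1, Thm. 5.8(d), §5.3] [cite: Grimmett2006, §3.9 eq. (3.94) (p. 63)] -/
theorem edgeNegCorrSupp_of_isTTSP [Fintype V] {q : ℝ} (hq0 : 0 < q) (hq1 : q ≤ 1) {E : Finset (Sym2 V)} {s t : V}
    (hE : IsTTSP E s t) : EdgeNegCorrSupp (↑(insert s(s, t) E) : Set (Sym2 V)) q :=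
  fun w hw e f he hfe => edgeNegCorr_supp_of_isTTSP_of_le_one hq0 hq1 hE w hw e f he hfe

/-- **… and of a 2-tree through the bridge** (a second route to fk-1's `FK.edgeNegCorrSupp_of_isTwoTree`, for comparison: every 2-tree
with a chosen edge `xy` is the completed TTSP support `T = (T) ∪ {xy}`). [cite: Wagner2006, Thm. 5.8(d), §5.3] -/
theorem edgeNegCorrSupp_of_isTwoTree' [Fintype V] {q : ℝ} (hq0 : 0 < q) (hq1 : q ≤ 1) {T : Set (Sym2 V)} (hT : IsTwoTree T)
    {x y : V} (hxy : s(x, y) ∈ T) : EdgeNegCorrSupp T q := by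
  obtain ⟨E, hE, hExy⟩ := IsTTSP.of_isTwoTree hT hxy
  have hins : (↑(insert s(x, y) E) : Set (Sym2 V)) = T := by
    rw [Finset.coe_insert, hE, Set.insert_eq_of_mem hxy]
  rw [← hins]
  exact edgeNegCorrSupp_of_isTTSP hq0 hq1 hExy

end FK

end Summit.CriticalPhenomena.PercolationContinuityZ3.Theorems

end
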